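import Mathlib
import Summits.Ventures.PercRepro2.AS3Cases
import Summits.Ventures.PercRepro2.PortPattern

/-!
# From the abstract pattern counts to product measures: pattern BAL ⟹ probability BAL for the
packing number of any event  (seat mine-b, cell pub-perc-repro2; conjectures/MINE-B.md §12)

mine-1's Bernstein expansion (`slack_nonneg_of_patternCoeff_nonneg`) turns the nonnegativity of all
two-configuration pattern coefficients `c(m, j)` into `P(F)P(G) ≥ P(H)P(K)` for every product measure.
Here the pattern coefficients of the PACKING events `packEvent A k = {ω : pack_A(open ω) ≥ k}` are
identified with the abstract pattern counts of AS3Cases.lean: at the pattern `(m, j)` with pins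
`M = open m` and split set `Y = open j ∖ M`,

  `c(m, j) = T(a, b) − T(a', b')` (`absT A M Y`),

the ordered pairs `(ω, ω')` with meet `m` and join `j` being parametrised by `γ ⊆ Y` (blue
`ω' = M ∪ γ`, red `ω = M ∪ (Y ∖ γ)`).  Consequently (`packTail_balanced_of_absT`): if the pattern
inequality `BAL(a, b)`, `T(a−1, b+1) ≤ T(a, b)`, holds on every pattern `(O, Y)` (disjoint `O`, `Y`),
then `P(pack ≥ a−1)·P(pack ≥ b+1) ≤ P(pack ≥ a)·P(pack ≥ b)` for every product measure — the
route from the row (REG-STEP) (pattern level) to the log-concave tail of the packing number of a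
regular port for every product measure.
-/

open Finset

namespace Summit.Ventures.PercRepro2

namespace StepZero

open ReimerCube

variable {E : Type*} [Fintype E] [DecidableEq E]

/-- the packing event `pack(open ω) ≥ k` of an event `A` on subsets -/
def packEvent (A : Finset E → Prop) (k : ℕ) : Set (Config E) := {ω | kDisj A k (openSet ω)}

/-- `ofFinset S ∈ packEvent A k ↔ kDisj A k S` -/
lemma ofFinset_mem_packEvent_iff (A : Finset E → Prop) (k : ℕ) (S : Finset E) :
    ofFinset S ∈ packEvent A k ↔ kDisj A k S := by
  simp only [packEvent, Set.mem_setOf_eq, openSet_ofFinset]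

/-- the open set of a meet is the intersection of the open sets -/
lemma openSet_inf (ω ω' : Config E) : openSet (ω ⊓ ω') = openSet ω ∩ openSet ω' := by
  ext e
  simp only [mem_openSet, Finset.mem_inter, Pi.inf_apply]
  have h := congrFun (congrFun Bool.inf_eq_band (ω e)) (ω' e)
  rw [h, Bool.and_eq_true]

/-- the open set of a join is the union of the open sets -/
lemma openSet_sup (ω ω' : Config E) : openSet (ω ⊔ ω') = openSet ω ∪ openSet ω' := by
  ext e
  simp only [mem_openSet, Finset.mem_union, Pi.sup_apply]
  have h := congrFun (congrFun Bool.sup_eq_bor (ω e)) (ω' e)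
  rw [h, Bool.or_eq_true]

/-- configurations with equal open sets are equal -/
lemma config_ext_openSet {ω ω' : Config E} (h : openSet ω = openSet ω') : ω = ω' := by
  rw [← ofFinset_openSet ω, ← ofFinset_openSet ω', h]

/-- the pair of the pattern `(M, Y)` at `γ ⊆ Y`: red `M ∪ (Y \ γ)`, blue `M ∪ γ` -/
def patPair (M Y γ : Finset E) : Config E × Config E :=
  (ofFinset (M ∪ (Y \ γ)), ofFinset (M ∪ γ))

/-- the meet and join of a pattern pair -/
lemma patPair_meet_join (M Y γ : Finset E) (hγ : γ ⊆ Y) (hMY : Disjoint M Y) :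
    (patPair M Y γ).1 ⊓ (patPair M Y γ).2 = ofFinset M
      ∧ (patPair M Y γ).1 ⊔ (patPair M Y γ).2 = ofFinset (M ∪ Y) := by
  have hγ' : ∀ e, e ∈ γ → e ∈ Y := fun e he => hγ he
  have hMY' : ∀ e, e ∈ M → e ∈ Y → False := fun e h1 h2 => Finset.disjoint_left.mp hMY h1 h2
  constructor
  · apply config_ext_openSet
    rw [openSet_inf]
    simp only [patPair, openSet_ofFinset]
    ext e
    simp only [Finset.mem_inter, Finset.mem_union, Finset.mem_sdiff]
    have := hγ' e
    have := hMY' e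
    tauto
  · apply config_ext_openSet
    rw [openSet_sup]
    simp only [patPair, openSet_ofFinset]
    ext e
    simp only [Finset.mem_union, Finset.mem_sdiff]
    have := hγ' e
    tauto

/-- every pair with meet `m` and join `j` is a pattern pair of `(open m, open j \ open m)` -/
lemma eq_patPair_of_meet_join {m j : Config E} {x : Config E × Config E}
    (hm : x.1 ⊓ x.2 = m) (hj : x.1 ⊔ x.2 = j) :
    x = patPair (openSet m) (openSet j \ openSet m) (openSet x.2 \ openSet m) := by
  have hm' : openSet x.1 ∩ openSet x.2 = openSet m := by rw [← openSet_inf, hm]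
  have hj' : openSet x.1 ∪ openSet x.2 = openSet j := by rw [← openSet_sup, hj]
  have hmE : ∀ e, e ∈ openSet m ↔ (e ∈ openSet x.1 ∧ e ∈ openSet x.2) := by
    intro e; rw [← hm']; simp
  have hjE : ∀ e, e ∈ openSet j ↔ (e ∈ openSet x.1 ∨ e ∈ openSet x.2) := by
    intro e; rw [← hj']; simp
  apply Prod.ext
  · apply config_ext_openSet
    simp only [patPair, openSet_ofFinset]
    ext e
    simp only [Finset.mem_union, Finset.mem_sdiff, hmE, hjE]
    tauto
  · apply config_ext_openSet
    simp only [patPair, openSet_ofFinset]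
    ext e
    simp only [Finset.mem_union, Finset.mem_sdiff, hmE]
    tauto

/-- `(if p then 1 else 0) * (if q then 1 else 0) = if p ∧ q then 1 else 0` -/
lemma ite_one_zero_mul (p q : Prop) [Decidable p] [Decidable q] :
    ((if p then (1 : ℝ) else 0) * (if q then (1 : ℝ) else 0)) = if p ∧ q then (1 : ℝ) else 0 := by
  by_cases hp : p <;> by_cases hq : q <;> simp [hp, hq]

open Classical in
/-- **The pattern coefficient of four packing events is a difference of abstract pattern counts**:
at the pattern `(m, j)` with `m ≤ j`, pins `M = open m`, split set `Y = open j \ M`,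
`c(m, j) = T(a, b) − T(a', b')`. -/
theorem patternCoeff_packEvent (A : Finset E → Prop) (a b a' b' : ℕ) (m j : Config E)
    (hmj : m ≤ j) :
    patternCoeff (packEvent A a) (packEvent A b) (packEvent A a') (packEvent A b') (m, j)
      = ((absT A (openSet m) (openSet j \ openSet m) a b : ℕ) : ℝ)
        - ((absT A (openSet m) (openSet j \ openSet m) a' b' : ℕ) : ℝ) := by
  have hMJ : openSet m ⊆ openSet j := by
    intro e he
    rw [mem_openSet] at he ⊢
    have := hmj e
    rw [he] at this
    exact Bool.eq_true_of_true_le this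
  have hMY : Disjoint (openSet m) (openSet j \ openSet m) := Finset.disjoint_sdiff
  have hMY_union : openSet m ∪ (openSet j \ openSet m) = openSet j := Finset.union_sdiff_of_subset hMJ
  -- the sum over the fibre, transported to `γ ⊆ Y`
  have hsum : patternCoeff (packEvent A a) (packEvent A b) (packEvent A a') (packEvent A b') (m, j)
      = ∑ γ ∈ (openSet j \ openSet m).powerset,
          pairTerm (R := ℝ) (packEvent A a) (packEvent A b) (packEvent A a') (packEvent A b')
            (patPair (openSet m) (openSet j \ openSet m) γ).1
            (patPair (openSet m) (openSet j \ openSet m) γ).2 := by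
    unfold patternCoeff
    rw [← Finset.sum_filter]
    apply Finset.sum_nbij' (fun x => openSet x.2 \ openSet m)
      (fun γ => patPair (openSet m) (openSet j \ openSet m) γ)
    · intro x hx
      have hx' : (x.1 ⊓ x.2, x.1 ⊔ x.2) = (m, j) := by simpa using hx
      have hj : x.1 ⊔ x.2 = j := (Prod.mk.inj hx').2
      show openSet x.2 \ openSet m ∈ (openSet j \ openSet m).powerset
      rw [Finset.mem_powerset]
      intro e he
      rw [Finset.mem_sdiff] at he ⊢
      refine ⟨?_, he.2⟩
      rw [← hj, openSet_sup]
      exact Finset.mem_union_right _ he.1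
    · intro γ hγ
      have hγ' : γ ⊆ openSet j \ openSet m := Finset.mem_powerset.mp (by simpa using hγ)
      obtain ⟨h1, h2⟩ := patPair_meet_join (openSet m) (openSet j \ openSet m) γ hγ' hMY
      have hpair : ((patPair (openSet m) (openSet j \ openSet m) γ).1
            ⊓ (patPair (openSet m) (openSet j \ openSet m) γ).2,
          (patPair (openSet m) (openSet j \ openSet m) γ).1
            ⊔ (patPair (openSet m) (openSet j \ openSet m) γ).2) = (m, j) := by
        rw [h1, h2, hMY_union, ofFinset_openSet, ofFinset_openSet]
      simpa using hpair
    · intro x hx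
      have hx' : (x.1 ⊓ x.2, x.1 ⊔ x.2) = (m, j) := by simpa using hx
      have hm : x.1 ⊓ x.2 = m := (Prod.mk.inj hx').1
      have hj : x.1 ⊔ x.2 = j := (Prod.mk.inj hx').2
      exact (eq_patPair_of_meet_join hm hj).symm
    · intro γ hγ
      have hγ' : γ ⊆ openSet j \ openSet m := Finset.mem_powerset.mp (by simpa using hγ)
      simp only [patPair, openSet_ofFinset]
      rw [Finset.union_sdiff_cancel_left (Finset.disjoint_of_subset_right hγ' hMY)]
    · intro x hx
      have hx' : (x.1 ⊓ x.2, x.1 ⊔ x.2) = (m, j) := by simpa using hx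
      have hm : x.1 ⊓ x.2 = m := (Prod.mk.inj hx').1
      have hj : x.1 ⊔ x.2 = j := (Prod.mk.inj hx').2
      have e := eq_patPair_of_meet_join hm hj
      rw [← e]
  rw [hsum]
  -- evaluate the pair term at pattern pairs
  have hterm : ∀ γ ∈ (openSet j \ openSet m).powerset,
      pairTerm (R := ℝ) (packEvent A a) (packEvent A b) (packEvent A a') (packEvent A b')
          (patPair (openSet m) (openSet j \ openSet m) γ).1
          (patPair (openSet m) (openSet j \ openSet m) γ).2
        = (if pinK A (openSet m) a ((openSet j \ openSet m) \ γ) ∧ pinK A (openSet m) b γ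
              then (1 : ℝ) else 0)
          - (if pinK A (openSet m) a' ((openSet j \ openSet m) \ γ) ∧ pinK A (openSet m) b' γ
              then (1 : ℝ) else 0) := by
    intro γ _
    unfold pairTerm
    simp only [patPair, ofFinset_mem_packEvent_iff]
    unfold pinK
    rw [ite_one_zero_mul, ite_one_zero_mul]
  rw [Finset.sum_congr rfl hterm, Finset.sum_sub_distrib, Finset.sum_boole, Finset.sum_boole]
  unfold absT
  congr 2

/-- pairs with meet `m` and join `j` force `m ≤ j`; otherwise the pattern coefficient vanishes -/
lemma patternCoeff_eq_zero_of_not_le (F G H K : Set (Config E)) (m j : Config E) (hmj : ¬ m ≤ j) :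
    patternCoeff (R := ℝ) F G H K (m, j) = 0 := by
  unfold patternCoeff
  apply Finset.sum_eq_zero
  intro x _
  rw [if_neg]
  intro h
  have hm : x.1 ⊓ x.2 = m := (Prod.mk.inj h).1
  have hj : x.1 ⊔ x.2 = j := (Prod.mk.inj h).2
  exact hmj (hm ▸ hj ▸ inf_le_sup)

/-- **Pattern BAL ⟹ probability BAL for the packing number of any event, for every product
measure**: if `T(a−1, b+1) ≤ T(a, b)` on every pattern `(O, Y)` with `O`, `Y` disjoint, then
`P(pack ≥ a−1)·P(pack ≥ b+1) ≤ P(pack ≥ a)·P(pack ≥ b)`. -/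
theorem packTail_balanced_of_absT {p : E → ℝ} (hp : IsProbVec p) (A : Finset E → Prop) (a b : ℕ)
    (h : ∀ O Y : Finset E, Disjoint O Y → absT A O Y (a - 1) (b + 1) ≤ absT A O Y a b) :
    prob p (packEvent A (a - 1)) * prob p (packEvent A (b + 1))
      ≤ prob p (packEvent A a) * prob p (packEvent A b) := by
  have hc : ∀ mj : Config E × Config E, (0 : ℝ) ≤ patternCoeff (packEvent A a) (packEvent A b)
      (packEvent A (a - 1)) (packEvent A (b + 1)) mj := by
    rintro ⟨m, j⟩
    by_cases hmj : m ≤ j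
    · rw [patternCoeff_packEvent A a b (a - 1) (b + 1) m j hmj]
      have := h (openSet m) (openSet j \ openSet m) Finset.disjoint_sdiff
      have h' : ((absT A (openSet m) (openSet j \ openSet m) (a - 1) (b + 1) : ℕ) : ℝ)
          ≤ ((absT A (openSet m) (openSet j \ openSet m) a b : ℕ) : ℝ) := by exact_mod_cast this
      linarith
    · rw [patternCoeff_eq_zero_of_not_le _ _ _ _ m j hmj]
  have hs := slack_nonneg_of_patternCoeff_nonneg hp (packEvent A a) (packEvent A b)
    (packEvent A (a - 1)) (packEvent A (b + 1)) hc
  unfold slack at hs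
  linarith

/-- the event `pack(open ω) = k` exactly -/
def packExact (A : Finset E → Prop) (k : ℕ) : Set (Config E) :=
  {ω | kDisj A k (openSet ω) ∧ ¬ kDisj A (k + 1) (openSet ω)}

/-- `ofFinset S ∈ packExact A k ↔ kDisj A k S ∧ ¬ kDisj A (k+1) S` -/
lemma ofFinset_mem_packExact_iff (A : Finset E → Prop) (k : ℕ) (S : Finset E) :
    ofFinset S ∈ packExact A k ↔ (kDisj A k S ∧ ¬ kDisj A (k + 1) S) := by
  simp only [packExact, Set.mem_setOf_eq, openSet_ofFinset]

open Classical in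
/-- **The pattern coefficient of the STEP quadruple `({= i+1}, {≥ j−1}, {= i}, {≥ j})` is
`H(i+1, j−1) − H(i, j)`** at every pattern `(m, j)` with `m ≤ j`. -/
theorem patternCoeff_packExact (A : Finset E → Prop) (i j' : ℕ) (m j : Config E) (hmj : m ≤ j) :
    patternCoeff (packExact A (i + 1)) (packEvent A (j' - 1)) (packExact A i) (packEvent A j') (m, j)
      = ((absH A (openSet m) (openSet j \ openSet m) (i + 1) (j' - 1) : ℕ) : ℝ)
        - ((absH A (openSet m) (openSet j \ openSet m) i j' : ℕ) : ℝ) := by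
  have hMJ : openSet m ⊆ openSet j := by
    intro e he
    rw [mem_openSet] at he ⊢
    have := hmj e
    rw [he] at this
    exact Bool.eq_true_of_true_le this
  have hMY : Disjoint (openSet m) (openSet j \ openSet m) := Finset.disjoint_sdiff
  have hMY_union : openSet m ∪ (openSet j \ openSet m) = openSet j := Finset.union_sdiff_of_subset hMJ
  have hsum : patternCoeff (packExact A (i + 1)) (packEvent A (j' - 1)) (packExact A i)
        (packEvent A j') (m, j)
      = ∑ γ ∈ (openSet j \ openSet m).powerset,
          pairTerm (R := ℝ) (packExact A (i + 1)) (packEvent A (j' - 1)) (packExact A i)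
            (packEvent A j')
            (patPair (openSet m) (openSet j \ openSet m) γ).1
            (patPair (openSet m) (openSet j \ openSet m) γ).2 := by
    unfold patternCoeff
    rw [← Finset.sum_filter]
    apply Finset.sum_nbij' (fun x => openSet x.2 \ openSet m)
      (fun γ => patPair (openSet m) (openSet j \ openSet m) γ)
    · intro x hx
      have hx' : (x.1 ⊓ x.2, x.1 ⊔ x.2) = (m, j) := by simpa using hx
      have hj : x.1 ⊔ x.2 = j := (Prod.mk.inj hx').2
      show openSet x.2 \ openSet m ∈ (openSet j \ openSet m).powerset
      rw [Finset.mem_powerset]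
      intro e he
      rw [Finset.mem_sdiff] at he ⊢
      refine ⟨?_, he.2⟩
      rw [← hj, openSet_sup]
      exact Finset.mem_union_right _ he.1
    · intro γ hγ
      have hγ' : γ ⊆ openSet j \ openSet m := Finset.mem_powerset.mp (by simpa using hγ)
      obtain ⟨h1, h2⟩ := patPair_meet_join (openSet m) (openSet j \ openSet m) γ hγ' hMY
      have hpair : ((patPair (openSet m) (openSet j \ openSet m) γ).1
            ⊓ (patPair (openSet m) (openSet j \ openSet m) γ).2,
          (patPair (openSet m) (openSet j \ openSet m) γ).1
            ⊔ (patPair (openSet m) (openSet j \ openSet m) γ).2) = (m, j) := by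
        rw [h1, h2, hMY_union, ofFinset_openSet, ofFinset_openSet]
      simpa using hpair
    · intro x hx
      have hx' : (x.1 ⊓ x.2, x.1 ⊔ x.2) = (m, j) := by simpa using hx
      have hm : x.1 ⊓ x.2 = m := (Prod.mk.inj hx').1
      have hj : x.1 ⊔ x.2 = j := (Prod.mk.inj hx').2
      exact (eq_patPair_of_meet_join hm hj).symm
    · intro γ hγ
      have hγ' : γ ⊆ openSet j \ openSet m := Finset.mem_powerset.mp (by simpa using hγ)
      simp only [patPair, openSet_ofFinset]
      rw [Finset.union_sdiff_cancel_left (Finset.disjoint_of_subset_right hγ' hMY)]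
    · intro x hx
      have hx' : (x.1 ⊓ x.2, x.1 ⊔ x.2) = (m, j) := by simpa using hx
      have hm : x.1 ⊓ x.2 = m := (Prod.mk.inj hx').1
      have hj : x.1 ⊔ x.2 = j := (Prod.mk.inj hx').2
      have e := eq_patPair_of_meet_join hm hj
      rw [← e]
  rw [hsum]
  have hterm : ∀ γ ∈ (openSet j \ openSet m).powerset,
      pairTerm (R := ℝ) (packExact A (i + 1)) (packEvent A (j' - 1)) (packExact A i) (packEvent A j')
          (patPair (openSet m) (openSet j \ openSet m) γ).1
          (patPair (openSet m) (openSet j \ openSet m) γ).2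
        = (if pinK A (openSet m) (i + 1) ((openSet j \ openSet m) \ γ)
              ∧ ¬ pinK A (openSet m) (i + 1 + 1) ((openSet j \ openSet m) \ γ)
              ∧ pinK A (openSet m) (j' - 1) γ then (1 : ℝ) else 0)
          - (if pinK A (openSet m) i ((openSet j \ openSet m) \ γ)
              ∧ ¬ pinK A (openSet m) (i + 1) ((openSet j \ openSet m) \ γ)
              ∧ pinK A (openSet m) j' γ then (1 : ℝ) else 0) := by
    intro γ _
    unfold pairTerm
    simp only [patPair, ofFinset_mem_packEvent_iff, ofFinset_mem_packExact_iff]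
    unfold pinK
    rw [ite_one_zero_mul, ite_one_zero_mul]
    congr 1 <;> congr 1 <;> exact propext and_assoc
  rw [Finset.sum_congr rfl hterm, Finset.sum_sub_distrib, Finset.sum_boole, Finset.sum_boole]
  unfold absH
  congr 2

/-- **Pattern STEP ⟹ probability STEP for the packing number of any event, for every product
measure**: if `H(i, j) ≤ H(i+1, j−1)` on every pattern `(O, Y)` with `O`, `Y` disjoint, then
`P(pack = i)·P(pack ≥ j) ≤ P(pack = i+1)·P(pack ≥ j−1)`. -/
theorem packStep_of_absH {p : E → ℝ} (hp : IsProbVec p) (A : Finset E → Prop) (i j' : ℕ)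
    (h : ∀ O Y : Finset E, Disjoint O Y → absH A O Y i j' ≤ absH A O Y (i + 1) (j' - 1)) :
    prob p (packExact A i) * prob p (packEvent A j')
      ≤ prob p (packExact A (i + 1)) * prob p (packEvent A (j' - 1)) := by
  have hc : ∀ mj : Config E × Config E, (0 : ℝ) ≤ patternCoeff (packExact A (i + 1))
      (packEvent A (j' - 1)) (packExact A i) (packEvent A j') mj := by
    rintro ⟨m, j⟩
    by_cases hmj : m ≤ j
    · rw [patternCoeff_packExact A i j' m j hmj]
      have := h (openSet m) (openSet j \ openSet m) Finset.disjoint_sdiff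
      have h' : ((absH A (openSet m) (openSet j \ openSet m) i j' : ℕ) : ℝ)
          ≤ ((absH A (openSet m) (openSet j \ openSet m) (i + 1) (j' - 1) : ℕ) : ℝ) := by
        exact_mod_cast this
      linarith
    · rw [patternCoeff_eq_zero_of_not_le _ _ _ _ m j hmj]
  have hs := slack_nonneg_of_patternCoeff_nonneg hp (packExact A (i + 1)) (packEvent A (j' - 1))
    (packExact A i) (packEvent A j') hc
  unfold slack at hs
  linarith

end StepZero

end Summit.Ventures.PercRepro2
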